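import Mathlib
import Literature.AlgebraicGeometry.Resolution.KiralyLutkebohmert
import Literature.AlgebraicGeometry.Resolution.KiralyLutkebohmertCriterionProofs

/-!
# S1a helper — the REES KILL LEMMA (abstract core) [OURS · L1 W4.5c · idea-2 g15 · card M]

NOT a statement of the manuscript; counted 0 (`--supports stmt-ResolutionOfSingularities-17941 --as helper`).
Role: the (E-a) END-STATE / leaf test of record for the producer stub `stub_localGame(T)` of the S1a lines
`s1a-logminvertex` (L) and `s1a-tamebr` (B) (plan-1 LANDABLE QUEUE 2026-08-27T19:39:06Z, item H1).
Source of record: HOME `L/res-L1-w45c-idea-2/cardM_g15/ReesKill.lean` 83f32b7de9ad3e71 + memo `cardM_g15/REES-KILL.md`.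
AI-level work, weaker than expert review.

## The geometric statement this file abstracts

Let `S = k[s, x']` be a chart of a σ-admissible weighted move of the (log) min-vertex game, with
SLICE lift `σ̂` (`σ̂(s) = μ·s`, `p ∤ w_c`), boundary monomial `ε = s^m·ε'` (`m ≥ 1`),
`I_σ̂ = ε·J'` (`J'` the residual ideal) and `θ = (σ̂ - 1)/ε`.  The Rees chart `C` of the move
carries the CANONICAL lift `σ̃` (`σ̃ T = T`); its Kummer cover `B := S[z, z⁻¹] ⊇ C`
(`μ_{w_c}`-torsor, étale) carries `Σ̃` with `Σ̃|_S = σ̂` and `Σ̃ z = μ⁻¹ z`.  Then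

  (R)   `I_Σ̃ · B = I_σ̂ · B + (μ - 1) · B`,

so the canonical lift is Király–Lütkebohmert-KILLED over a point `Q ∈ E = V(s)` as soon as
`I_σ̂ S_Q ⊆ (μ - 1) S_Q`; and since `μ - 1 = ε · θ(s)/s` (with `θ(s) ∈ (s)`, checked on the whole
DATA13 census: 33/33 nodes), this holds iff `J' = (1)` at `Q` (slice KILL) or
`b := (θ(s)/s)(Q) ≠ 0` (MULTIPLICATIVE point = the game's TAME-EXIT; then `(μ - 1) = (ε)` near `Q`
and `I_Σ̃ B = (ε)` is principal — a monomial).  By `KiralyLutkebohmertRegularity` (tree, PROVED)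
`B^Σ̃` is regular there, and the quotient chart `Spec (C^σ̃)₀ = Spec B^{Σ̃ × 𝔾_m × μ_{w_c}}` is a
good quotient of a regular scheme by a diagonalisable group, i.e. a tame root chart
(`S1.IsTameRootChart`, D2-T): the (B)/EXIT leaf.
CONSEQUENCE: at every leaf of the censused game (KILL or TAME-EXIT, depth ≥ 1) the END-STATE
CLAIM (E-a) of record holds with ZERO extra moves and NO frame / rank / exactness hypothesis.

## What is kernel-checked here

* `augmentationIdeal_eq_span_of_unit` — the abstract form of (R) ⟹ KILL: if `B` is generated by a
  set `G` and a unit `z`, `σ g - g ∈ (ν)` for `g ∈ G`, and `σ z⁻¹ = (1 + ν) z⁻¹` (`1 + ν = μ`), then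
  `augmentationIdeal σ = (ν)`.  (In the chart: `G` = generators of `S`, `ν = μ - 1`, hypothesis
  `I_σ̂ ⊆ (μ - 1)`.)
* `invariants_regular_of_unit_generator` — chained with the tree's PROVED
  `KiralyLutkebohmertRegularity_holds`: under the same hypotheses on a regular local `B` with `σ`
  of prime order, `B^σ` is regular and `B` is free over it.
* `sub_one_mem_augmentationIdeal_of_unit` — the converse bookkeeping `(μ - 1) ⊆ I_Σ̃` (always).
* `toy_artinSchreier_invariant`, `toy_U_invariant` — the char-`p` identities behind the hand-worked
  example (`σ(u,v) = (u/(1+u), v/(1+v))`, chart `u` of `Bl_0`, `Σ̃ z = (1+s) z`): with `U = s z`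
  invariant, `z ↦ z + U` is a translation and `W = z^p - U^{p-1} z` is invariant.
-/

set_option linter.dupNamespace false

namespace Summit.ResolutionOfSingularities.ResolutionOfSingularities.Theorems.WildQuotientResolution.S1.ReesKill

open Literature.AlgebraicGeometry.Resolution

universe u

section Abstract

variable {B : Type u} [CommRing B]

/-- The elements `b` with `σ b - b ∈ I` form a subring (any ideal `I`, any ring endomorphism). -/
def movedWithin (σ : B ≃+* B) (I : Ideal B) : Subring B where
  carrier := {b | σ b - b ∈ I}
  mul_mem' {a b} ha hb := by
    simp only [Set.mem_setOf_eq, map_mul] at *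
    have : σ a * σ b - a * b = σ a * (σ b - b) + (σ a - a) * b := by ring
    rw [this]; exact I.add_mem (I.mul_mem_left _ hb) (I.mul_mem_right _ ha)
  one_mem' := by simp
  add_mem' {a b} ha hb := by
    simp only [Set.mem_setOf_eq, map_add] at *
    have : σ a + σ b - (a + b) = (σ a - a) + (σ b - b) := by ring
    rw [this]; exact I.add_mem ha hb
  zero_mem' := by simp
  neg_mem' {a} ha := by
    simp only [Set.mem_setOf_eq, map_neg] at *
    have : -σ a - -a = -(σ a - a) := by ring
    rw [this]; exact I.neg_mem ha

/-- Membership in `movedWithin σ I`: `σ b - b ∈ I`. -/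
theorem mem_movedWithin_iff (σ : B ≃+* B) (I : Ideal B) (b : B) :
    b ∈ movedWithin σ I ↔ σ b - b ∈ I := Iff.rfl

/-- **REES KILL LEMMA (abstract core).** If `B` is generated (as a ring) by a set `G` together with a
unit `z` and its inverse, every `g ∈ G` satisfies `σ g - g ∈ (ν)`, and `σ z⁻¹ = (1 + ν) · z⁻¹`, then
the augmentation ideal of `σ` IS `(ν)` — in particular principal.
Chart reading: `B = S[z, z⁻¹]` the Kummer cover of the Rees chart, `G` = generators of the slice
chart `S`, `σ = Σ̃` the canonical lift, `1 + ν = μ = σ̂(s)/s`; hypothesis = `I_σ̂ ⊆ (μ - 1)`, which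
holds at slice-KILL points and at every MULTIPLICATIVE (`b ≠ 0`, TAME-EXIT) point.
[OURS, AI-level] -/
theorem augmentationIdeal_eq_span_of_unit (σ : B ≃+* B) (G : Set B) (z : Bˣ) (ν : B)
    (hgen : Subring.closure (insert (z : B) (insert ((z⁻¹ : Bˣ) : B) G)) = ⊤)
    (hG : ∀ g ∈ G, σ g - g ∈ Ideal.span ({ν} : Set B))
    (hz : σ ((z⁻¹ : Bˣ) : B) = (1 + ν) * ((z⁻¹ : Bˣ) : B)) :
    augmentationIdeal σ = Ideal.span ({ν} : Set B) := by
  have hzz : ((z⁻¹ : Bˣ) : B) * (z : B) = 1 := by simp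
  apply le_antisymm
  · -- every generator `σ b - b` lies in `(ν)`: the moved-within-`(ν)` elements form a subring ⊇ G, z, z⁻¹
    unfold augmentationIdeal
    rw [Ideal.span_le]
    rintro _ ⟨b, rfl⟩
    have hsub : insert (z : B) (insert ((z⁻¹ : Bˣ) : B) G) ⊆ (movedWithin σ (Ideal.span {ν}) : Set B) := by
      intro x hx
      rcases hx with rfl | hx
      · -- x = z :  σ z · σ z⁻¹ = 1 and σ z⁻¹ = (1+ν) z⁻¹  ⇒  σ z · (1 + ν) = z  ⇒  σ z - z = -σ z · ν
        show σ (z : B) - z ∈ Ideal.span {ν}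
        have h1 : σ (z : B) * σ ((z⁻¹ : Bˣ) : B) = 1 := by
          rw [← map_mul, Units.mul_inv, map_one]
        rw [hz] at h1
        have h2 : σ (z : B) * (1 + ν) = z := by
          calc σ (z : B) * (1 + ν) = σ (z : B) * (1 + ν) * (((z⁻¹ : Bˣ) : B) * z) := by
                rw [hzz, mul_one]
            _ = (σ (z : B) * ((1 + ν) * ((z⁻¹ : Bˣ) : B))) * z := by ring
            _ = z := by rw [h1, one_mul]
        have h3 : σ (z : B) - z = ν * (-σ (z : B)) := by linear_combination h2
        rw [h3]; exact Ideal.mul_mem_right _ _ (Ideal.mem_span_singleton_self ν)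
      rcases hx with rfl | hx
      · -- x = z⁻¹
        show σ ((z⁻¹ : Bˣ) : B) - ((z⁻¹ : Bˣ) : B) ∈ Ideal.span {ν}
        rw [hz]
        have : (1 + ν) * ((z⁻¹ : Bˣ) : B) - ((z⁻¹ : Bˣ) : B) = ν * ((z⁻¹ : Bˣ) : B) := by ring
        rw [this]; exact Ideal.mul_mem_right _ _ (Ideal.mem_span_singleton_self ν)
      · exact hG x hx
    have hb : b ∈ movedWithin σ (Ideal.span {ν}) := by
      have hcl : Subring.closure (insert (z : B) (insert ((z⁻¹ : Bˣ) : B) G)) ≤ movedWithin σ (Ideal.span {ν}) :=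
        Subring.closure_le.mpr hsub
      exact hcl (by rw [hgen]; trivial)
    exact hb
  · -- `ν = (σ z⁻¹ - z⁻¹) · z` lies in the augmentation ideal
    rw [Ideal.span_singleton_le_iff_mem]
    have h := sub_mem_augmentationIdeal σ ((z⁻¹ : Bˣ) : B)
    rw [hz] at h
    have : ((1 + ν) * ((z⁻¹ : Bˣ) : B) - ((z⁻¹ : Bˣ) : B)) * z = ν := by
      calc _ = ν * (((z⁻¹ : Bˣ) : B) * z) := by ring
        _ = ν := by rw [hzz, mul_one]
    rw [← this]; exact Ideal.mul_mem_right _ _ h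

/-- **REES KILL ⟹ INVARIANTS REGULAR** (the abstract core chained with Király–Lütkebohmert, which is
PROVED in the tree as `KiralyLutkebohmertRegularity_holds`): for a regular local ring `B`, an
automorphism `σ` of prime order `p`, and `G, z, ν` as in `augmentationIdeal_eq_span_of_unit`, the ring
of invariants `B^σ` is a regular local ring and `B` is a free `B^σ`-module.
Chart reading: `B` = the local ring of the Kummer cover of the Rees chart at a point over a KILL or
MULTIPLICATIVE (TAME-EXIT) point; conclusion = K–L KILL of the canonical lift one dimension up, whence
the quotient chart is a diagonalisable-group quotient of a regular ring (toric ⇒ log regular ⇒ EXIT).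
[OURS, AI-level] -/
theorem invariants_regular_of_unit_generator {B : Type u} [CommRing B] [IsRegularLocalRing B]
    (p : ℕ) (hp : p.Prime) (σ : B ≃+* B) (hσp : ∀ b : B, (⇑σ)^[p] b = b)
    (hσ : σ ≠ RingEquiv.refl B) (G : Set B) (z : Bˣ) (ν : B)
    (hgen : Subring.closure (insert (z : B) (insert ((z⁻¹ : Bˣ) : B) G)) = ⊤)
    (hG : ∀ g ∈ G, σ g - g ∈ Ideal.span ({ν} : Set B))
    (hz : σ ((z⁻¹ : Bˣ) : B) = (1 + ν) * ((z⁻¹ : Bˣ) : B)) :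
    IsRegularLocalRing (invariantSubring σ) ∧ Module.Free (invariantSubring σ) B := by
  have hI : (augmentationIdeal σ).IsPrincipal := by
    rw [augmentationIdeal_eq_span_of_unit σ G z ν hgen hG hz]
    exact ⟨⟨ν, rfl⟩⟩
  exact KiralyLutkebohmertRegularity_holds B p σ hp hσp hσ hI

/-- Converse bookkeeping used in the memo: whatever the hypotheses, `ν` always lies in the
augmentation ideal once `σ z⁻¹ = (1 + ν) z⁻¹` for a unit `z` — so `I_Σ̃ ⊇ (μ - 1)` on every chart,
and the canonical lift's residual ideal is `J' + (θ(s)/s)`, never `J'` alone. [OURS] -/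
theorem sub_one_mem_augmentationIdeal_of_unit (σ : B ≃+* B) (z : Bˣ) (ν : B)
    (hz : σ ((z⁻¹ : Bˣ) : B) = (1 + ν) * ((z⁻¹ : Bˣ) : B)) :
    ν ∈ augmentationIdeal σ := by
  have hzz : ((z⁻¹ : Bˣ) : B) * (z : B) = 1 := by simp
  have h := sub_mem_augmentationIdeal σ ((z⁻¹ : Bˣ) : B)
  rw [hz] at h
  have : ((1 + ν) * ((z⁻¹ : Bˣ) : B) - ((z⁻¹ : Bˣ) : B)) * z = ν := by
    calc _ = ν * (((z⁻¹ : Bˣ) : B) * z) := by ring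
      _ = ν := by rw [hzz, mul_one]
  rw [← this]; exact Ideal.mul_mem_right _ _ h

end Abstract

section Toy

/-- The char-`p` identity behind the hand-worked example of the memo: if `U = s·z` is invariant and
`z ↦ (1 + s) z = z + U`, then `W = z^p - U^{p-1} z` is invariant:
`((1+s) z)^p - (s z)^{p-1} (1+s) z = z^p - (s z)^{p-1} z`. [OURS] -/
theorem toy_artinSchreier_invariant {R : Type*} [CommRing R] (p : ℕ) [Fact p.Prime] [CharP R p]
    (s z : R) :
    ((1 + s) * z) ^ p - (s * z) ^ (p - 1) * ((1 + s) * z) = z ^ p - (s * z) ^ (p - 1) * z := by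
  have hp : 1 ≤ p := (Fact.out : p.Prime).one_lt.le
  have h1 : ((1 + s) * z) ^ p = z ^ p + s ^ p * z ^ p := by
    rw [mul_pow, add_pow_char 1 s p, one_pow]; ring
  have h2 : (s * z) ^ (p - 1) * (s * z) = (s * z) ^ p := by
    rw [← pow_succ, Nat.sub_add_cancel hp]
  have h3 : (s * z) ^ (p - 1) * ((1 + s) * z) = (s * z) ^ (p - 1) * z + (s * z) ^ p := by
    rw [← h2]; ring
  rw [h1, h3, mul_pow]; ring

/-- The translation normal form of the toy example as exact identities over any commutative ring in
which the denominators are units: with `Σ̃ s = s·(1+s)⁻¹`, `Σ̃ v = v (1+s) (1 + s v)⁻¹`, `Σ̃ z = (1+s) z`,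
the element `U = s z` is invariant — `(s (1+s)⁻¹)·((1+s) z) = s z`. [OURS] -/
theorem toy_U_invariant {R : Type*} [CommRing R] (s z i : R) (hi : (1 + s) * i = 1) :
    (s * i) * ((1 + s) * z) = s * z := by
  calc (s * i) * ((1 + s) * z) = s * z * ((1 + s) * i) := by ring
    _ = s * z := by rw [hi, mul_one]

end Toy

end Summit.ResolutionOfSingularities.ResolutionOfSingularities.Theorems.WildQuotientResolution.S1.ReesKill
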